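import Summits.CriticalPhenomena.SAWScalingLimit.Theses.SAWTrackTransport
import Literature.Probability.RandomPlanarGeometry.YangBaxterSAWCylinder
import Literature.Probability.RandomPlanarGeometry.YangBaxterSAWLaw

/-!
# Sketch — first lemmas of the three crux ideas for `AngleUniversality` (stmt-CriticalPhenomena-16963)

crux-ideate round 1, ideator 1.  Nothing is proved here; each `def … : Prop` is the first checkable
statement of one idea card, stated over existing declarations only.
-/

noncomputable section

namespace Summit.CriticalPhenomena.SAWScalingLimit.Cruxes.AngleUniversality.IdeateR1K1

open MeasureTheory Filter Topology
open Literature.Probability.RandomPlanarGeometry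
open Literature.Probability.RandomPlanarGeometry.SAW.YangBaxter

/-- The route's robust-full-limit predicate `RL α P`, copied verbatim from the `let RL := …` of
`Theses/SAWTrackTransport.lean` (it is not a stand-alone declaration there). -/
def RL (α : ℝ) (P : ChordalFamily) : Prop :=
  ∀ (D : DobrushinDomain) (u : ℝ → ℂ) (a b : ℝ → MidEdge), (∀ᶠ δ in 𝓝[>] (0 : ℝ), ‖u δ‖ ≤ δ) →
    (∀ᶠ δ in 𝓝[>] (0 : ℝ), Nonempty (YangBaxterSAW (fun (_ : ℤ) => α)
      ((D.map (similarity 1 one_ne_zero (u δ))).carrier) δ (a δ) (b δ))) →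
    Tendsto (fun δ : ℝ => (δ : ℂ) * planeMidpoint (fun (_ : ℤ) => α) (a δ)) (𝓝[>] (0 : ℝ)) (𝓝 (D.pt 0)) →
    Tendsto (fun δ : ℝ => (δ : ℂ) * planeMidpoint (fun (_ : ℤ) => α) (b δ)) (𝓝[>] (0 : ℝ)) (𝓝 (D.pt 1)) →
    TendstoLaw (fun δ (γ : YangBaxterSAW (fun (_ : ℤ) => α)
        ((D.map (similarity 1 one_ne_zero (u δ))).carrier) δ (a δ) (b δ)) => γ.curve (fun (_ : ℤ) => α) δ)
      (fun δ => ybLaw (fun (_ : ℤ) => α) ((D.map (similarity 1 one_ne_zero (u δ))).carrier) δ 1 (a δ) (b δ))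
      id (P D)

/-- Sanity: the crux is literally `∀ α ∈ Icc, ∀ P, IsChordal P → RL (π/2) P → RL α P`. -/
example : Theses.SAWTrackTransport.AngleUniversality ↔
    ∀ α ∈ Set.Icc (Real.pi / 3) (2 * Real.pi / 3), ∀ P : ChordalFamily,
      P.IsChordal → RL (Real.pi / 2) P → RL α P := Iff.rfl

/-! ## Card A — `angle-free-environments`: first lemma -/

/-- **EnvironmentInvariance (m = 0 sector).** If the column transfer matrices of two angles
commute (the registered `stub_columnCommute` at `m = 0`), and for each of them (i) the vacuum row of
`V^K` converges entrywise and (ii) every non-vacuum row of `V^K` tends to `0`, then the two limits —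
the total weights `E_θ(s)` of all multi-arch systems of the half-infinite cylinder with wall data
`s` — COINCIDE.  Pure linear algebra given `V ∅ ∅ = 1` (`YBCylinderTransferMatrix_vacuum`) and
`V t ∅ = 0` for `t ≠ ∅` (no closed loop); (i) ⇐ arch weights bounded by `Σ_L G(0,L) = 1/cos(3π/8)`,
(ii) ⇐ `B_K → 0` (GM Thm 2), both in the tree. -/
def EnvironmentInvariance : Prop :=
  ∀ α ∈ Set.Icc (Real.pi / 3) (2 * Real.pi / 3), ∀ β ∈ Set.Icc (Real.pi / 3) (2 * Real.pi / 3),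
    ∀ (N : ℕ) [NeZero N] (E F : YBCylinderState N 0 → ℝ),
      YBCylinderTransferMatrix α N 0 * YBCylinderTransferMatrix β N 0 =
        YBCylinderTransferMatrix β N 0 * YBCylinderTransferMatrix α N 0 →
      (∀ s, Tendsto (fun K : ℕ => (YBCylinderTransferMatrix α N 0 ^ K) (YBCylinderState.vacuum N) s)
        atTop (𝓝 (E s))) →
      (∀ s, Tendsto (fun K : ℕ => (YBCylinderTransferMatrix β N 0 ^ K) (YBCylinderState.vacuum N) s)
        atTop (𝓝 (F s))) →
      (∀ t s, t ≠ YBCylinderState.vacuum N →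
        Tendsto (fun K : ℕ => (YBCylinderTransferMatrix α N 0 ^ K) t s) atTop (𝓝 0)) →
      (∀ t s, t ≠ YBCylinderState.vacuum N →
        Tendsto (fun K : ℕ => (YBCylinderTransferMatrix β N 0 ^ K) t s) atTop (𝓝 0)) →
      E = F

/-- The two analytic inputs of `EnvironmentInvariance`, as one statement (to be proved from
GM Thm 1/2, in tree): vacuum rows of `V(θ)^K` converge, non-vacuum rows vanish. -/
def EnvironmentExists : Prop :=
  ∀ θ ∈ Set.Icc (Real.pi / 3) (2 * Real.pi / 3), ∀ (N : ℕ) [NeZero N],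
    (∀ s, ∃ E : ℝ, Tendsto (fun K : ℕ => (YBCylinderTransferMatrix θ N 0 ^ K) (YBCylinderState.vacuum N) s)
        atTop (𝓝 E)) ∧
    (∀ t s, t ≠ YBCylinderState.vacuum N →
        Tendsto (fun K : ℕ => (YBCylinderTransferMatrix θ N 0 ^ K) t s) atTop (𝓝 0))

/-! ## Card B — `two-phase-domain-transport`: first lemma -/

/-- **BoundaryAvoidance (constant angle; the only a-priori input the collar costs).** For the
critical Yang–Baxter walk in a Dobrushin domain, the probability that the drawn curve comes
within distance `r` of `∂D` at distance `≥ ε` from both marked points tends to `0` as `r → 0`,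
uniformly in the mesh (stated in `∀ η, ∃ r, ∀ᶠ δ` form; the truth is `≍ r`, boundary one-point
exponent `8/κ − 1 = 2`). Used at time `0` (angle `π/2`) and time `T` (angle `α`) of the transport
only, so no hybrid tiling appears. -/
def BoundaryAvoidance : Prop :=
  ∀ θ ∈ Set.Icc (Real.pi / 3) (2 * Real.pi / 3), ∀ (D : DobrushinDomain) (a b : ℝ → MidEdge),
    IsYBEndpointApprox (fun (_ : ℤ) => θ) D a b → ∀ ε > (0 : ℝ), ∀ η > (0 : ℝ), ∃ r > (0 : ℝ),
      ∀ᶠ δ in 𝓝[>] (0 : ℝ),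
        (ybLaw (fun (_ : ℤ) => θ) D.carrier δ 1 (a δ) (b δ)).real
          {γ | ∃ e ∈ γ.mids,
              Metric.infDist ((δ : ℂ) * planeMidpoint (fun (_ : ℤ) => θ) e) (frontier D.carrier) ≤ r ∧
              ε ≤ dist ((δ : ℂ) * planeMidpoint (fun (_ : ℤ) => θ) e) (D.pt 0) ∧
              ε ≤ dist ((δ : ℂ) * planeMidpoint (fun (_ : ℤ) => θ) e) (D.pt 1)} ≤ η

/-! ## Card C — `wall-anchored-restriction`: first lemma -/

/-- **RestrictionRatioFromHypothesis.** Exact lattice restriction makes `Z_{D'}/Z_D = P_D[γ ⊆ D'_δ]`;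
if `D' ⊆ D` share the marked points AND AGREE NEAR THEM, the crux's own hypothesis `RL(π/2) P`
(applied to `D` and to `D'` with the same endpoint family) forces this ratio to converge to a
POSITIVE limit — no RSW-type lower bound is needed on the square side. Non-degeneracy hypotheses:
the limit laws charge curves avoiding `closure (D ∖ D')`. -/
def RestrictionRatioFromHypothesis : Prop :=
  ∀ P : ChordalFamily, P.IsChordal → RL (Real.pi / 2) P →
    ∀ (D D' : DobrushinDomain), D'.carrier ⊆ D.carrier → D'.pt 0 = D.pt 0 → D'.pt 1 = D.pt 1 →
      (∃ ε > (0 : ℝ), D.carrier ∩ Metric.ball (D.pt 0) ε ⊆ D'.carrier ∧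
        D.carrier ∩ Metric.ball (D.pt 1) ε ⊆ D'.carrier) →
      0 < P D' {γ | Disjoint γ.range (closure (D.carrier \ D'.carrier))} →
      0 < P D {γ | Disjoint γ.range (closure (D.carrier \ D'.carrier))} →
      ∀ (a b : ℝ → MidEdge), IsYBEndpointApprox (fun (_ : ℤ) => Real.pi / 2) D' a b →
        ∃ c : ℝ, 0 < c ∧
          Tendsto (fun δ : ℝ =>
              (ybWeight (fun (_ : ℤ) => Real.pi / 2) D'.carrier δ 1 (a δ) (b δ) Set.univ).toReal /
              (ybWeight (fun (_ : ℤ) => Real.pi / 2) D.carrier δ 1 (a δ) (b δ) Set.univ).toReal)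
            (𝓝[>] (0 : ℝ)) (𝓝 c)

/-- The exact lattice identity behind card C (provable now, via `YBWalk.mapDomain`): the weight of a
set of walks of the smaller domain equals the weight of its image among the walks of the larger. -/
def LatticeRestriction : Prop :=
  ∀ (Θ : ℤ → ℝ) (Ω Ω' : Set ℂ) (hΩ : Ω' ⊆ Ω) (δ x : ℝ) (a b : MidEdge)
    (S : Set (YangBaxterSAW Θ Ω' δ a b)),
    ybWeight Θ Ω' δ x a b S =
      ybWeight Θ Ω δ x a b ((fun γ : YangBaxterSAW Θ Ω' δ a b =>
        (YBWalk.mapDomain (meshFaces_mono Θ hΩ δ) γ : YangBaxterSAW Θ Ω δ a b)) '' S)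

end Summit.CriticalPhenomena.SAWScalingLimit.Cruxes.AngleUniversality.IdeateR1K1
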